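import Summits.PneNP.PneNP.Theorems.RootDecompSegregatorSmallSegregators.Negative.KSS2

/-!
# K\*\* — proofs 3/6 (`KSS3`)

Proof file 3/6 of the kernel refutation of the route item `RootDecompSegregator.SmallSegregators`
(stmt-PneNP-26297; deciding theorem `Summit.PneNP.PneNP.Theorems.RootDecompSegregatorSmallSegregators_refuted`
in `Theorems/RootDecompSegregatorSmallSegregatorsRefutation.lean`; definitions in `Defs.lean` of this
directory).  Topic: lemmas `dbCount` … `flatten_range_split2`.

PROVENANCE.  Mathematics and Lean text by the decomp-pnenp cell's lens-1 lineage (work file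
`decomp-pnenp-lens-1/SegregatorPageThreshold.lean`, generations 4–5, v5 sha256 `099856e2…`, brief
`KSS-DoubleButterfly.md`): the dependency cone of its theorem `not_smallSegregators`, extracted verbatim by
the cell critic and split into files of at most 400 lines (docstrings added where missing).  No declaration
here mentions a Theses item; the chain ends in `ancestorRobust_three : AncestorRobust 3 160 12` (last file),
from which the flat refutation file concludes `¬ SmallSegregators` by the kill switch
`not_smallSegregatorsAt_of_ancestorRobust` at `r = 3`, `k = 172`.
-/

namespace Summit.PneNP.PneNP.Theorems.RootDecompSegregatorSmallSegregators.Negative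

open Relation
open StackOp

section KSSCount
open Finset

/-- **K\*\* counting lemma, kernel version.** `DBCount κ` holds for every `κ`. -/
theorem dbCount (κ : ℕ) : DBCount κ := by
  classical
  intro L T E D J hL5 hJ
  have hL : 1 ≤ L := by omega
  have hMpos : 0 < 2 ^ L := by positivity
  -- (P1) few blocked vertices
  have hBl : (Bltot D J).card ≤ κ * J.card := card_Bltot_le D J
  -- (B2) the funnel: some top `o` is reached from almost all of the middle level
  have hΦ := phi_bound (D := D) (J := J) hL L le_rfl
  obtain ⟨o, hoM, ho⟩ : ∃ o ∈ range (2 ^ L), 2 ^ L ≤ (G D J o L).card + Sbl (D := D) (J := J) L := by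
    apply exists_le_of_sum_le (nonempty_range_iff.2 hMpos.ne')
    rw [sum_const, card_range, smul_eq_mul, sum_add_distrib, sum_const, card_range, smul_eq_mul]
    unfold Phi at hΦ
    linarith
  have hoM' : o < 2 ^ L := mem_range.1 hoM
  -- (B1) every lower level keeps the mass
  have hlow : ∀ lam, lam < L → 2 ^ L ≤ (G D J o (2 * L - lam)).card + (Bltot D J).card := by
    intro lam hlam
    have h1 := lower_bound_G ho (2 * L - lam) (by omega)
    have h2 := sbl_le_card_Bltot (D := D) (J := J) (d := 2 * L - lam) (by omega)
    omega
  -- the top `o` is unblocked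
  have hSblL : Sbl (D := D) (J := J) L ≤ (Bltot D J).card := sbl_le_card_Bltot (by omega)
  have hGne : (G D J o L).Nonempty := by
    rw [← card_pos]
    have : 16 * (Bltot D J).card ≤ 2 ^ L := le_trans (by linarith) hJ
    omega
  have hotop : ¬ blocked D J (2 * L) o := unblocked_top_of_G_nonempty L hGne
  obtain ⟨hβo, -⟩ := (unblocked_iff D J).1 hotop
  refine ⟨o, hoM', hβo, ?_⟩
  -- (P4) the good lower vertices and their (distinct up to κ) births
  set S := ((range L) ×ˢ (range (2 ^ L))).filter (fun p : ℕ × ℕ => p.2 ∈ G D J o (2 * L - p.1)) with hS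
  have hScard : S.card = ∑ lam ∈ range L, (G D J o (2 * L - lam)).card := by
    rw [hS, card_filter_product_range]
    refine sum_congr rfl (fun lam _ => ?_)
    congr 1
    ext z
    simp only [mem_filter, mem_range, and_iff_right_iff_imp]
    exact fun hz => lt_of_mem_G hz
  have hSmass : L * 2 ^ L ≤ S.card + L * (Bltot D J).card := by
    rw [hScard]
    have : ∑ _lam ∈ range L, 2 ^ L ≤ ∑ lam ∈ range L, ((G D J o (2 * L - lam)).card + (Bltot D J).card) :=
      sum_le_sum (fun lam hlam => hlow lam (mem_range.1 hlam))
    rw [sum_const, card_range, smul_eq_mul, sum_add_distrib, sum_const, card_range, smul_eq_mul] at this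
    exact this
  set f : ℕ × ℕ → ℕ := fun p => D.β p.1 p.2 with hf
  have hanc : ∀ p ∈ S, f p ∈ ancestorsAvoiding E J (D.β (2 * L) o) := by
    intro p hp
    obtain ⟨hp1, hp2⟩ := mem_filter.1 hp
    have hlamL : p.1 < L := mem_range.1 (mem_product.1 hp1).1
    have := beta_mem_anc_of_mem_G (D := D) (J := J) o (2 * L - p.1) (by omega) (by omega) p.2 hp2
    have e : 2 * L - (2 * L - p.1) = p.1 := by omega
    rw [e] at this
    exact this
  have himg : (S.image f).card ≤ (ancestorsAvoiding E J (D.β (2 * L) o)).ncard := by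
    rw [← Set.ncard_coe_finset]
    refine Set.ncard_le_ncard ?_ (ancestorsAvoiding_finite E J _)
    intro t ht
    obtain ⟨p, hp, rfl⟩ := mem_image.1 (mem_coe.1 ht)
    exact hanc p hp
  have hfib : S.card ≤ κ * (S.image f).card := by
    refine card_le_mul_card_image S κ (fun t _ => ?_)
    have hsub : S.filter (fun p => f p = t) ⊆ ((range (2 * L + 1)) ×ˢ (range (2 ^ L))).filter
        (fun p => t = D.β p.1 p.2 ∨ t ∈ D.carrier p.1 p.2) := by
      intro p hp
      obtain ⟨hpS, hpt⟩ := mem_filter.1 hp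
      obtain ⟨hp1, -⟩ := mem_filter.1 hpS
      obtain ⟨ha, hb⟩ := mem_product.1 hp1
      refine mem_filter.2 ⟨mem_product.2 ⟨mem_range.2 (by have := mem_range.1 ha; omega), hb⟩, ?_⟩
      exact Or.inl hpt.symm
    exact le_trans (card_le_card hsub) (D.charge t)
  have hk : κ * (S.image f).card ≤ κ * (ancestorsAvoiding E J (D.β (2 * L) o)).ncard :=
    Nat.mul_le_mul_left κ himg
  have hLB : L * (16 * (Bltot D J).card) ≤ L * 2 ^ L :=
    Nat.mul_le_mul_left L (le_trans (by linarith) hJ)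
  nlinarith [hSmass, hfib, hk, hLB, himg]

end KSSCount

namespace TSB

/-! #### Generic LIFO toolkit: final stack, append, prefix-balance, matching -/

/-- K\*\* cone (auxiliary lemma): `lifoArcs_append`. -/
theorem lifoArcs_append (a b : List StackOp) : ∀ (t : ℕ) (st : List ℕ),
    lifoArcs (a ++ b) t st = lifoArcs a t st ∪ lifoArcs b (t + a.length) (lifoStack a t st) := by
  induction a with
  | nil => intro t st; simp [lifoArcs, lifoStack]
  | cons op a ih =>
    intro t st
    have e : t + (a.length + 1) = t + 1 + a.length := by omega
    cases op with
    | push => simp only [List.cons_append, lifoArcs, lifoStack, ih, List.length_cons, e]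
    | pop =>
      cases st with
      | nil => simp only [List.cons_append, lifoArcs, lifoStack, ih, List.length_cons, e]
      | cons p st =>
        simp only [List.cons_append, lifoArcs, lifoStack, ih, List.length_cons, e, Finset.insert_union]
    | skip => simp only [List.cons_append, lifoArcs, lifoStack, ih, List.length_cons, e]

/-- Running a prefix-disciplined segment never digs below depth `d`, and the depth bookkeeping is exact. -/
theorem lifoStack_PD : ∀ (l : List StackOp) (t : ℕ) (s₁ s₂ : List ℕ), PD s₁.length l →
    ∃ s₁' : List ℕ, lifoStack l t (s₁ ++ s₂) = s₁' ++ s₂ ∧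
      s₁'.length + l.count pop = s₁.length + l.count push := by
  intro l
  induction l with
  | nil => intro t s₁ s₂ _; exact ⟨s₁, rfl, by simp⟩
  | cons op l ih =>
    intro t s₁ s₂ h
    cases op with
    | push =>
      have h' : PD (t :: s₁).length l := by
        intro n
        have := h (n + 1)
        simp only [List.take_succ_cons, List.count_cons_self, List.length_cons] at this ⊢
        rw [List.count_cons_of_ne (by decide)] at this
        omega
      obtain ⟨s₁', hs, hc⟩ := ih (t + 1) (t :: s₁) s₂ h'
      refine ⟨s₁', by simpa [lifoStack] using hs, ?_⟩
      simp only [List.count_cons_self, List.length_cons] at hc ⊢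
      rw [List.count_cons_of_ne (by decide)]
      omega
    | pop =>
      have h1 := h 1
      cases s₁ with
      | nil =>
        exfalso
        simp at h1
      | cons a s₁ =>
        have h' : PD s₁.length l := by
          intro n
          have := h (n + 1)
          simp only [List.take_succ_cons, List.count_cons_self, List.length_cons] at this ⊢
          rw [List.count_cons_of_ne (by decide)] at this
          omega
        obtain ⟨s₁', hs, hc⟩ := ih (t + 1) s₁ s₂ h'
        refine ⟨s₁', by simpa [lifoStack] using hs, ?_⟩
        simp only [List.count_cons_self, List.length_cons] at hc ⊢
        rw [List.count_cons_of_ne (by decide)]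
        omega
    | skip =>
      have h' : PD s₁.length l := by
        intro n
        have := h (n + 1)
        simp only [List.take_succ_cons] at this ⊢
        rw [List.count_cons_of_ne (by decide), List.count_cons_of_ne (by decide)] at this
        exact this
      obtain ⟨s₁', hs, hc⟩ := ih (t + 1) s₁ s₂ h'
      refine ⟨s₁', by simpa [lifoStack] using hs, ?_⟩
      rw [List.count_cons_of_ne (by decide), List.count_cons_of_ne (by decide)]
      exact hc

/-- **Matching lemma.** A push followed, after a balanced prefix-disciplined segment `mid`, by a pop
creates the arc `(push time, pop time)`. -/
theorem mem_lifoArcs_match (pre mid post : List StackOp) (t : ℕ) (st : List ℕ)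
    (hPD : PD 0 mid) (hbal : mid.count pop = mid.count push) :
    (t + pre.length, t + pre.length + 1 + mid.length) ∈
      lifoArcs (pre ++ push :: (mid ++ pop :: post)) t st := by
  rw [lifoArcs_append]
  apply Finset.mem_union_right
  simp only [lifoArcs]
  rw [lifoArcs_append]
  apply Finset.mem_union_right
  obtain ⟨s₁', hs, hc⟩ := lifoStack_PD mid (t + pre.length + 1) [] ((t + pre.length) :: lifoStack pre t st)
    (by simpa using hPD)
  have hnil : s₁' = [] := by
    rw [← List.length_eq_zero_iff]; simp at hc; omega
  rw [hnil] at hs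
  simp only [List.nil_append] at hs
  rw [hs]
  simp [lifoArcs]

/-! #### PD calculus -/

/-- K\*\* cone (auxiliary lemma): `PD_mono`. -/
theorem PD_mono {d d' : ℕ} {l : List StackOp} (h : PD d l) (hd : d ≤ d') : PD d' l :=
  fun n => le_trans (h n) (by omega)

/-- K\*\* cone (auxiliary lemma): `PD_append`. -/
theorem PD_append {d e : ℕ} {a b : List StackOp} (ha : PD d a)
    (hcnt : a.count pop + e = a.count push + d) (hb : PD e b) : PD d (a ++ b) := by
  intro n
  rw [List.take_append, List.count_append, List.count_append]
  by_cases hn : n ≤ a.length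
  · have : n - a.length = 0 := by omega
    rw [this, List.take_zero]
    simpa using ha n
  · rw [List.take_of_length_le (by omega)]
    have := hb (n - a.length)
    omega

/-- K\*\* cone (auxiliary lemma): `PD_nil`. -/
theorem PD_nil (d : ℕ) : PD d [] := fun n => by simp

/-- K\*\* cone (auxiliary lemma): `PD_replicate_push`. -/
theorem PD_replicate_push (d n : ℕ) : PD d (List.replicate n push) := by
  intro k; simp [List.take_replicate, List.count_replicate]

/-- K\*\* cone (auxiliary lemma): `PD_replicate_skip`. -/
theorem PD_replicate_skip (d n : ℕ) : PD d (List.replicate n skip) := by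
  intro k; simp [List.take_replicate, List.count_replicate]

/-- K\*\* cone (auxiliary lemma): `PD_replicate_pop`. -/
theorem PD_replicate_pop {d n : ℕ} (h : n ≤ d) : PD d (List.replicate n pop) := by
  intro k
  simp [List.take_replicate, List.count_replicate]
  omega

/-- K\*\* cone (auxiliary lemma): `count_flatten_replicate`. -/
theorem count_flatten_replicate (a : StackOp) (m : ℕ) (l : List StackOp) :
    (List.replicate m l).flatten.count a = m * l.count a := by
  induction m with
  | zero => simp
  | succ m ih => simp [List.replicate_succ, List.count_append, ih]; ring

/-- Surplus blocks: a `PD 0` block with nonnegative surplus repeats into a `PD d` list for every `d`. -/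
theorem PD_flatten_replicate_surplus {blk : List StackOp} (h0 : PD 0 blk)
    (hs : blk.count pop ≤ blk.count push) : ∀ (m d : ℕ), PD d (List.replicate m blk).flatten := by
  intro m
  induction m with
  | zero => intro d; simpa using PD_nil d
  | succ m ih =>
    intro d
    rw [List.replicate_succ, List.flatten_cons]
    exact PD_append (PD_mono h0 (Nat.zero_le _)) (e := d + blk.count push - blk.count pop) (by omega) (ih _)

/-- Deficit blocks: a block needing depth `B` and consuming `c` repeats `m` times under depth `m*c + B`… we
state the exact form used: blocks `PD B`-disciplined with `pop = push + c` repeat under depth `d ≥ m*c + (B - c)`. -/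
theorem PD_flatten_replicate_deficit {blk : List StackOp} {B c : ℕ} (hB : ∀ d, B ≤ d → PD d blk)
    (hcnt : blk.count pop = blk.count push + c) (hcB : c ≤ B) :
    ∀ (m d : ℕ), m * c + (B - c) ≤ d → PD d (List.replicate m blk).flatten := by
  intro m
  induction m with
  | zero => intro d _; simpa using PD_nil d
  | succ m ih =>
    intro d hd
    rw [List.replicate_succ, List.flatten_cons]
    have hBd : B ≤ d := by
      have : (m + 1) * c = m * c + c := by ring
      omega
    refine PD_append (hB d hBd) (e := d - c) ?_ (ih _ ?_)
    · omega
    · have : (m + 1) * c = m * c + c := by ring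
      omega

/-! #### List surgery -/

/-- K\*\* cone (auxiliary lemma): `replicate_split`. -/
theorem replicate_split {α : Type*} (a : α) {n i : ℕ} (hi : i < n) :
    List.replicate n a = List.replicate i a ++ a :: List.replicate (n - i - 1) a := by
  have : n = i + (1 + (n - i - 1)) := by omega
  conv_lhs => rw [this]
  rw [List.replicate_add, List.replicate_add]
  simp

/-- K\*\* cone (auxiliary lemma): `flatten_replicate_split`. -/
theorem flatten_replicate_split {α : Type*} (l : List α) {m j : ℕ} (hj : j < m) :
    (List.replicate m l).flatten =
      (List.replicate j l).flatten ++ l ++ (List.replicate (m - j - 1) l).flatten := by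
  rw [replicate_split l hj]
  simp [List.flatten_append]

/-- K\*\* cone (auxiliary lemma): `flatten_range_split`. -/
theorem flatten_range_split {α : Type*} (f : ℕ → List α) {n k : ℕ} (hk : k < n) :
    ((List.range n).map f).flatten = ((List.range k).map f).flatten ++ f k ++
      ((List.range (n - k - 1)).map (fun i => f (k + 1 + i))).flatten := by
  have : n = k + (1 + (n - k - 1)) := by omega
  conv_lhs => rw [this]
  rw [List.range_add, List.range_add]
  simp [List.flatten_append, List.map_map, Function.comp_def, Nat.add_assoc]

/-- K\*\* cone (auxiliary lemma): `length_flatten_replicate`. -/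
theorem length_flatten_replicate {α : Type*} (m : ℕ) (l : List α) :
    (List.replicate m l).flatten.length = m * l.length := by
  induction m with
  | zero => simp
  | succ m ih => simp [List.replicate_succ, ih]; ring

/-- K\*\* cone (auxiliary lemma): `length_flatten_range_const`. -/
theorem length_flatten_range_const {α : Type*} (f : ℕ → List α) (c : ℕ) :
    ∀ n, (∀ i, i < n → (f i).length = c) → ((List.range n).map f).flatten.length = n * c := by
  intro n
  induction n with
  | zero => intro _; simp
  | succ n ih =>
    intro h
    rw [List.range_succ, List.map_append, List.flatten_append, List.length_append,
      ih (fun i hi => h i (by omega))]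
    simp [h n (by omega)]
    ring

/-! #### Two-level split of a range-indexed flatten -/

/-- K\*\* cone (auxiliary lemma): `flatten_range_split2`. -/
theorem flatten_range_split2 {α : Type*} (f : ℕ → List α) {n k : ℕ} (hk : k + 1 < n) :
    ((List.range n).map f).flatten = ((List.range k).map f).flatten ++ f k ++ f (k + 1) ++
      ((List.range (n - k - 2)).map (fun i => f (k + 1 + 1 + i))).flatten := by
  have : n = k + (1 + (1 + (n - k - 2))) := by omega
  conv_lhs => rw [this]
  rw [List.range_add, List.range_add, List.range_add]
  simp [List.flatten_append, List.map_map, Function.comp_def, Nat.add_assoc]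
  refine congrArg List.flatten (List.map_congr_left (fun i _ => ?_))
  congr 1; omega

section Schedule

end Schedule

end TSB

end Summit.PneNP.PneNP.Theorems.RootDecompSegregatorSmallSegregators.Negative
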